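import Mathlib
import Literature.Computability.AlgebraicComplexity.GroupTheoreticMatMul
import Literature.Barriers.MatrixMultiplication.TricoloredSumFreeBarrier
import Literature.Combinatorics.Additive.Pollard
import Summits.MatrixMultiplication.MatrixMultiplication.Theorems.AbelianSTPPSieveVP
import Summits.MatrixMultiplication.MatrixMultiplication.Theorems.AbelianSTPPCensusVPBookkeeping
import Summits.MatrixMultiplication.MatrixMultiplication.Theorems.AbelianSTPPCensusFP2Defs

/-!
# Rule U11-F2 (index-2 fibred Pollard) is SOUND: `IsSTPP ⇒ FP2Adm`

Cell mm-stpp (rung F-M1), PRE-REG v1 band B3 «past the walls» (seat mm-stpp-theory, gen 13).  The shape-level predicate `FP2.FP2Adm`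
(`AbelianSTPPCensusFP2Defs.lean`) holds on the shape data of every STPP family with non-empty sets in a finite abelian group `H`:
`FP2.fp2Adm_of_isSTPP` / `FP2.fp2Sound` (the census's item format, like `e3Adm_of_isSTPP`, `u11PSound`).

PROOF.  Nothing to show unless `|H| = 2p` with `p` prime.  Then Cauchy's theorem (`exists_prime_addOrderOf_dvd_card`) gives `g` of
order `p`; `P = ℤg` has `Nat.card P = p` (`Nat.card_zmultiples`), hence index `2` (`AddSubgroup.card_mul_index`), so
`u + w ∈ P ↔ (u ∈ P ↔ w ∈ P)` (`AddSubgroup.add_mem_iff_of_index_two`).  With `X = ⋃(B − A)`, `Y = ⋃(C − B)`, `Z′ = ⋃(C − A)`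
(tree `diffUnion`, sizes `P_AB, P_BC, P_CA` by `STPPRepCount.card_diffUnion_*`) split as `X₀ = X ∩ P`, `X₁ = X ∖ P`, …:
* `r_{X,Y} = r_{X₀,Y₀} + r_{X₀,Y₁} + r_{X₁,Y₀} + r_{X₁,Y₁}` (`repCount_union_left/right`), the mixed terms vanish on `P` and the pure
  terms vanish off `P` (`repCount_eq_zero` + index two);
* **Pollard inside a coset** (`pairFloor_le_Nt_coset`): for `U ⊆ g + P`, `V ⊆ g′ + P` and `t ≤ min(|U|,|V|)`,
  `t·min(p, |U|+|V|−t) ≤ N_t(U,V)` — translate into `P` (`repCount_translate`, `Nt_translate`), restrict to `↥P` (`repCount_subtype`),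
  apply the tree's `STPPRepCount.pollard_of_addEquiv` with `↥P ≃+ ℤ/p` (`nonempty_addEquiv_zmod_of_prime_card`);
* `cosetIneq_of`: the two pair floors of a coset are `≤ Σ_{w ∈ coset} min(T, r_{X,Y}(w))` (`min` is super-additive), which is
  `≤ W·min(T, v) + T·(p − W)` because `r_{X,Y} = b_i ≤ v = max b` on `C_i − A_i` (`STPPRepCount.repCount_eq`) and the coset has `p`
  elements; `mass_of`: `W ≤ Σ_{w ∈ Z′∩coset} r(w) ≤` the number of pairs landing in the coset (`sum_repCount`);
* `formOK_of_isSTPP` assembles form B; forms A and C are form B of the rotated families `(C,A,B)`, `(B,C,A)` (`IsSTPP.rotate`), after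
  identifying the classes of `⋃(A − C)` and `⋃(C − A)` etc. by negation (`card_filter_diffUnion_swap`).
WHAT THIS IS NOT: no census number and no `ω` statement — a necessary condition (its first kill is `AbelianSTPPCensusFP2Wall478.lean`);
silent at orders not of the form `2p`.  References: J. M. Pollard, J. London Math. Soc. (2) 8 (1974) 460–462 (tree
`Literature.Combinatorics.Additive.pollard`; Nathanson GTM 165 Thm 2.4); CKSU 2005 Def. 5.1 (`IsSTPP`); B. Green, I. Z. Ruzsa, Israel J. Math.
147 (2005) Prop. 6.1 (context: the defect form of Pollard–Kneser, too weak at these orders).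
-/

set_option linter.dupNamespace false -- `MatrixMultiplication.MatrixMultiplication` (summit = problem, D-0017)
set_option autoImplicit false

namespace Summit.MatrixMultiplication.MatrixMultiplication.Theorems

open Finset

namespace FP2

/-! ### Soundness: `IsSTPP ⇒ FP2Adm` -/

section Sound

open Literature.Computability.AlgebraicComplexity STPPRepCount
open scoped Pointwise

variable {H : Type*} [AddCommGroup H] [DecidableEq H]

/-! #### Representation counts: disjoint unions, vanishing, totals, translation, restriction to a subgroup -/

/-- `repCount` is additive in the first set over a disjoint union. [bookkeeping] -/
theorem repCount_union_left {U U' : Finset H} (V : Finset H) (h : Disjoint U U') (w : H) :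
    repCount (U ∪ U') V w = repCount U V w + repCount U' V w := by
  unfold repCount
  rw [union_product, filter_union, card_union_of_disjoint]
  exact disjoint_filter_filter (disjoint_product.mpr (Or.inl h))

/-- `repCount` is additive in the second set over a disjoint union. [bookkeeping] -/
theorem repCount_union_right (U : Finset H) {V V' : Finset H} (h : Disjoint V V') (w : H) :
    repCount U (V ∪ V') w = repCount U V w + repCount U V' w := by
  unfold repCount
  rw [product_union, filter_union, card_union_of_disjoint]
  exact disjoint_filter_filter (disjoint_product.mpr (Or.inr h))

/-- `repCount U V w = 0` when no pair sums to `w`. [bookkeeping] -/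
theorem repCount_eq_zero {U V : Finset H} {w : H} (h : ∀ u ∈ U, ∀ v ∈ V, u + v ≠ w) : repCount U V w = 0 := by
  unfold repCount
  rw [card_eq_zero, filter_eq_empty_iff]
  rintro ⟨u, v⟩ huv
  rw [mem_product] at huv
  exact h u huv.1 v huv.2

/-- `Σ_w r_{U,V}(w) = |U| |V|`. [bookkeeping] -/
theorem sum_repCount [Fintype H] (U V : Finset H) : ∑ w, repCount U V w = U.card * V.card := by
  unfold repCount
  rw [← card_product]
  exact (card_eq_sum_card_fiberwise fun x _ => mem_coe.mpr (mem_univ (x.1 + x.2))).symm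

/-- Translating `U` by `g` and `V` by `g'` translates the representation count by `g + g'`. [bookkeeping] -/
theorem repCount_translate (U V : Finset H) (g g' w : H) :
    repCount (U.image (· + g)) (V.image (· + g')) (w + (g + g')) = repCount U V w := by
  unfold repCount
  refine card_bij' (fun q _ => (q.1 - g, q.2 - g')) (fun q _ => (q.1 + g, q.2 + g')) ?_ ?_ ?_ ?_
  · rintro ⟨x, y⟩ hq
    simp only [mem_filter, mem_product, mem_image] at hq ⊢
    obtain ⟨⟨⟨u, hu, rfl⟩, ⟨v, hv, rfl⟩⟩, he⟩ := hq
    refine ⟨⟨by simpa using hu, by simpa using hv⟩, ?_⟩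
    have : u + v = w := by
      have := he; rw [show u + g + (v + g') = (u + v) + (g + g') by abel] at this; exact add_right_cancel this
    simpa using this
  · rintro ⟨x, y⟩ hq
    simp only [mem_filter, mem_product, mem_image] at hq ⊢
    obtain ⟨⟨hx, hy⟩, he⟩ := hq
    refine ⟨⟨⟨x, hx, rfl⟩, ⟨y, hy, rfl⟩⟩, ?_⟩
    rw [← he]; abel
  · rintro ⟨x, y⟩ _; simp
  · rintro ⟨x, y⟩ _; simp

/-- `N_t` is invariant under translating the two sets. [bookkeeping] -/
theorem Nt_translate [Fintype H] (U V : Finset H) (g g' : H) (t : ℕ) :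
    Nt (U.image (· + g)) (V.image (· + g')) t = Nt U V t := by
  unfold Nt
  refine (Fintype.sum_equiv (Equiv.addRight (g + g')) _ _ fun w => ?_).symm
  rw [Equiv.coe_addRight, repCount_translate]

/-- For sets inside a subgroup `P`, the representation count at a point of `P` is the representation count of the restricted sets in `↥P`.
[bookkeeping] -/
theorem repCount_subtype (P : AddSubgroup H) [DecidablePred (· ∈ P)] {U V : Finset H} (hU : ∀ u ∈ U, u ∈ P) (hV : ∀ v ∈ V, v ∈ P)
    (q : P) : repCount (U.subtype (· ∈ P)) (V.subtype (· ∈ P)) q = repCount U V (q : H) := by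
  unfold repCount
  refine card_bij' (fun x _ => ((x.1 : H), (x.2 : H))) (fun x hx => (⟨x.1, hU x.1 ?_⟩, ⟨x.2, hV x.2 ?_⟩)) ?_ ?_ ?_ ?_
  · exact (mem_product.mp (mem_filter.mp hx).1).1
  · exact (mem_product.mp (mem_filter.mp hx).1).2
  · rintro ⟨u, v⟩ hq
    simp only [mem_filter, mem_product, mem_subtype] at hq ⊢
    exact ⟨hq.1, by rw [← hq.2]; rfl⟩
  · rintro ⟨u, v⟩ hq
    simp only [mem_filter, mem_product, mem_subtype] at hq ⊢
    exact ⟨hq.1, Subtype.ext (by simpa using hq.2)⟩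
  · rintro ⟨u, v⟩ _; rfl
  · rintro ⟨u, v⟩ _; rfl

/-- **Pollard's theorem inside a subgroup of prime order**: for `U, V ⊆ P`, `|P| = p` prime, `1 ≤ t ≤ min(|U|,|V|)`:
`t·min(p, |U| + |V| − t) ≤ N_t(U,V)` (the sum over the whole group; Pollard for `↥P ≃+ ℤ/p`, tree `pollard_of_addEquiv`).
[cite: Pollard1974, Thm 1] -/
theorem pairFloor_le_Nt_of_subset [Fintype H] (P : AddSubgroup H) [DecidablePred (· ∈ P)] {p : ℕ} [Fact p.Prime]
    (hP : (univ.filter (· ∈ P)).card = p) {U V : Finset H} (hU : ∀ u ∈ U, u ∈ P) (hV : ∀ v ∈ V, v ∈ P)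
    {t : ℕ} (ht : 1 ≤ t) (htU : t ≤ U.card) (htV : t ≤ V.card) :
    pairFloor p U.card V.card t ≤ Nt U V t := by
  have hcard : Fintype.card P = p := by rw [← hP, Fintype.card_subtype]
  have hprime : (Fintype.card P).Prime := hcard ▸ Fact.out
  obtain ⟨e⟩ := nonempty_addEquiv_zmod_of_prime_card hprime
  let e' : P ≃+ ZMod p := e.trans (ZMod.ringEquivCongr hcard).toAddEquiv
  set U' : Finset P := U.subtype (· ∈ P)
  set V' : Finset P := V.subtype (· ∈ P)
  have hU' : U'.card = U.card := by
    rw [card_subtype, filter_true_of_mem hU]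
  have hV' : V'.card = V.card := by
    rw [card_subtype, filter_true_of_mem hV]
  have hPol := pollard_of_addEquiv e' U' V' ht (hU' ▸ htU) (hV' ▸ htV)
  rw [hU', hV'] at hPol
  refine hPol.trans ?_
  unfold Nt
  calc ∑ q : P, min t (repCount U' V' q) = ∑ q : P, min t (repCount U V (q : H)) := by
        refine Finset.sum_congr rfl fun q _ => ?_; rw [repCount_subtype P hU hV]
    _ = ∑ w ∈ (univ : Finset P).map (Function.Embedding.subtype _), min t (repCount U V w) := by
        rw [sum_map]; rfl
    _ ≤ ∑ w, min t (repCount U V w) := sum_le_sum_of_subset (subset_univ _)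

/-- **Pollard's theorem inside a coset pair**: `U ⊆ g + P`, `V ⊆ g' + P`, `|P| = p` prime, `t ≤ min(|U|,|V|)` (any `t`, the case
`t = 0` being trivial): `pairFloor p |U| |V| t ≤ N_t(U,V)`. [cite: Pollard1974, Thm 1] -/
theorem pairFloor_le_Nt_coset [Fintype H] (P : AddSubgroup H) [DecidablePred (· ∈ P)] {p : ℕ} [Fact p.Prime]
    (hP : (univ.filter (· ∈ P)).card = p) {U V : Finset H} (g g' : H) (hU : ∀ u ∈ U, u - g ∈ P) (hV : ∀ v ∈ V, v - g' ∈ P)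
    {t : ℕ} (htU : t ≤ U.card) (htV : t ≤ V.card) :
    pairFloor p U.card V.card t ≤ Nt U V t := by
  rcases Nat.eq_zero_or_pos t with rfl | ht
  · simp [pairFloor]
  have hinjg : Function.Injective (fun x : H => x + -g) := add_left_injective _
  have hinjg' : Function.Injective (fun x : H => x + -g') := add_left_injective _
  have h1 : pairFloor p (U.image (· + -g)).card (V.image (· + -g')).card t ≤ Nt (U.image (· + -g)) (V.image (· + -g')) t :=
    pairFloor_le_Nt_of_subset P hP
      (fun u hu => by obtain ⟨x, hx, rfl⟩ := mem_image.mp hu; simpa [sub_eq_add_neg] using hU x hx)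
      (fun v hv => by obtain ⟨x, hx, rfl⟩ := mem_image.mp hv; simpa [sub_eq_add_neg] using hV x hx)
      ht (by rwa [card_image_of_injective _ hinjg]) (by rwa [card_image_of_injective _ hinjg'])
  rwa [card_image_of_injective _ hinjg, card_image_of_injective _ hinjg', Nt_translate] at h1

/-! #### The coset inequality and the mass bound, abstractly -/

/-- **One coset of the rule.**  Pairs `(U, V)`, `(U', V')` inside coset pairs whose sums lie in the coset `Q` (`|Q| = p`), jointly
dominated by `r = r_{X,Y}`; target `Zq ⊆ Q` on which `r ≤ v`: then `CosetIneq p |U| |V| |U'| |V'| |Zq| v`. [original] -/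
theorem cosetIneq_of [Fintype H] (P : AddSubgroup H) [DecidablePred (· ∈ P)] {p : ℕ} [Fact p.Prime]
    (hP : (univ.filter (· ∈ P)).card = p) (U V U' V' X Y Q Zq : Finset H) (v : ℕ) (gU gV gU' gV' : H)
    (hU : ∀ u ∈ U, u - gU ∈ P) (hV : ∀ u ∈ V, u - gV ∈ P) (hU' : ∀ u ∈ U', u - gU' ∈ P) (hV' : ∀ u ∈ V', u - gV' ∈ P)
    (hsupp : ∀ w, w ∉ Q → repCount U V w = 0 ∧ repCount U' V' w = 0)
    (hdom : ∀ w, repCount U V w + repCount U' V' w ≤ repCount X Y w)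
    (hQ : Q.card = p) (hZq : Zq ⊆ Q) (hv : ∀ w ∈ Zq, repCount X Y w ≤ v) :
    CosetIneq p U.card V.card U'.card V'.card Zq.card v := by
  intro s₀ s₁ h0U h0V h1U h1V
  have e0 := pairFloor_le_Nt_coset P hP gU gV hU hV h0U h0V
  have e1 := pairFloor_le_Nt_coset P hP gU' gV' hU' hV' h1U h1V
  -- the two `N_s` live on `Q`
  have hNt : ∀ (S T : Finset H) (s : ℕ), (∀ w, w ∉ Q → repCount S T w = 0) →
      Nt S T s = ∑ w ∈ Q, min s (repCount S T w) := by
    intro S T s hz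
    unfold Nt
    rw [← sum_filter_add_sum_filter_not univ (· ∈ Q)]
    have hz' : ∑ w ∈ univ.filter (fun w => ¬ w ∈ Q), min s (repCount S T w) = 0 :=
      sum_eq_zero fun w hw => by rw [hz w (mem_filter.mp hw).2, Nat.min_zero]
    rw [hz', add_zero, filter_mem_eq_inter, univ_inter]
  rw [hNt U V s₀ fun w hw => (hsupp w hw).1] at e0
  rw [hNt U' V' s₁ fun w hw => (hsupp w hw).2] at e1
  -- floor ≤ Σ_{w ∈ Q} min(T, r w)
  have step : pairFloor p U.card V.card s₀ + pairFloor p U'.card V'.card s₁ ≤ ∑ w ∈ Q, min (s₀ + s₁) (repCount X Y w) := by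
    refine (Nat.add_le_add e0 e1).trans ?_
    rw [← sum_add_distrib]
    refine sum_le_sum fun w _ => ?_
    have := hdom w
    omega
  refine step.trans ?_
  -- ceiling: split `Q` into `Zq` and the rest
  rw [← sum_sdiff hZq]
  have hA : ∑ w ∈ Q \ Zq, min (s₀ + s₁) (repCount X Y w) ≤ (s₀ + s₁) * (p - Zq.card) := by
    calc ∑ w ∈ Q \ Zq, min (s₀ + s₁) (repCount X Y w) ≤ ∑ w ∈ Q \ Zq, (s₀ + s₁) := sum_le_sum fun w _ => min_le_left _ _
      _ = (s₀ + s₁) * (p - Zq.card) := by rw [sum_const, smul_eq_mul, card_sdiff_of_subset hZq, hQ, mul_comm]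
  have hB : ∑ w ∈ Zq, min (s₀ + s₁) (repCount X Y w) ≤ Zq.card * min (s₀ + s₁) v := by
    calc ∑ w ∈ Zq, min (s₀ + s₁) (repCount X Y w) ≤ ∑ w ∈ Zq, min (s₀ + s₁) v :=
          sum_le_sum fun w hw => min_le_min_left _ (hv w hw)
      _ = Zq.card * min (s₀ + s₁) v := by rw [sum_const, smul_eq_mul]
  omega

/-- **Mass bound of one coset.**  If on `Q` the count `r = r_{X,Y}` is dominated by the two pair counts and `r ≥ 1` on `Zq ⊆ Q`, then
`|Zq| ≤ |U||V| + |U'||V'|`. [original] -/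
theorem mass_of [Fintype H] (U V U' V' X Y Q Zq : Finset H)
    (hle : ∀ w ∈ Q, repCount X Y w ≤ repCount U V w + repCount U' V' w)
    (hZq : Zq ⊆ Q) (hpos : ∀ w ∈ Zq, 1 ≤ repCount X Y w) :
    Zq.card ≤ U.card * V.card + U'.card * V'.card := by
  calc Zq.card = ∑ w ∈ Zq, 1 := by rw [sum_const, smul_eq_mul, mul_one]
    _ ≤ ∑ w ∈ Zq, repCount X Y w := sum_le_sum hpos
    _ ≤ ∑ w ∈ Q, repCount X Y w := sum_le_sum_of_subset hZq
    _ ≤ ∑ w ∈ Q, (repCount U V w + repCount U' V' w) := sum_le_sum hle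
    _ = ∑ w ∈ Q, repCount U V w + ∑ w ∈ Q, repCount U' V' w := sum_add_distrib
    _ ≤ ∑ w, repCount U V w + ∑ w, repCount U' V' w :=
        Nat.add_le_add (sum_le_sum_of_subset (subset_univ _)) (sum_le_sum_of_subset (subset_univ _))
    _ = U.card * V.card + U'.card * V'.card := by rw [sum_repCount, sum_repCount]

/-! #### The rule for an STPP family -/

/-- Negation maps `⋃ (B_j − A_j)` onto `⋃ (A_j − B_j)` and preserves the class modulo `P`. [bookkeeping] -/
theorem card_filter_diffUnion_swap [Fintype H] {N : ℕ} (P : AddSubgroup H) [DecidablePred (· ∈ P)] (A B : Fin N → Finset H) :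
    ((diffUnion B A).filter (· ∈ P)).card = ((diffUnion A B).filter (· ∈ P)).card := by
  refine card_bij' (fun x _ => -x) (fun x _ => -x) ?_ ?_ (fun x _ => neg_neg x) (fun x _ => neg_neg x)
  · intro x hx
    simp only [mem_filter, diffUnion, mem_biUnion, mem_univ, true_and] at hx ⊢
    obtain ⟨⟨j, hj⟩, hxP⟩ := hx
    rw [mem_sub] at hj
    obtain ⟨a, ha, b, hb, rfl⟩ := hj
    exact ⟨⟨j, by rw [neg_sub]; exact sub_mem_sub hb ha⟩, P.neg_mem hxP⟩
  · intro x hx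
    simp only [mem_filter, diffUnion, mem_biUnion, mem_univ, true_and] at hx ⊢
    obtain ⟨⟨j, hj⟩, hxP⟩ := hx
    rw [mem_sub] at hj
    obtain ⟨b, hb, a, ha, rfl⟩ := hj
    exact ⟨⟨j, by rw [neg_sub]; exact sub_mem_sub ha hb⟩, P.neg_mem hxP⟩

omit [DecidableEq H] in
/-- Elements of a finset avoiding the index-2 subgroup `P` differ from a common base point by elements of `P`. [bookkeeping] -/
theorem exists_base_of_not_mem (P : AddSubgroup H) (hadd : ∀ u v : H, u + v ∈ P ↔ (u ∈ P ↔ v ∈ P)) (S : Finset H)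
    (hS : ∀ u ∈ S, u ∉ P) : ∃ g : H, ∀ u ∈ S, u - g ∈ P := by
  rcases S.eq_empty_or_nonempty with rfl | ⟨x, hx⟩
  · exact ⟨0, by simp⟩
  · refine ⟨x, fun u hu => ?_⟩
    rw [sub_eq_add_neg, hadd]
    exact ⟨fun h => absurd h (hS u hu), fun h => absurd (P.neg_mem_iff.mp h) (hS x hx)⟩

/-- **Form B of rule U11-F2 for an STPP family** (non-empty sets) in a finite abelian group of order `2p` with a subgroup `P` of order
`p` prime: the coset counts of `X`, `Y`, `Z′` in `P` pass `FormOK`. [original] -/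
theorem formOK_of_isSTPP [Fintype H] {N : ℕ} {A B C : Fin N → Finset H} (h : IsSTPP A B C)
    (hA : ∀ i, (A i).Nonempty) (hB : ∀ i, (B i).Nonempty) (hC : ∀ i, (C i).Nonempty)
    (P : AddSubgroup H) [DecidablePred (· ∈ P)] {p : ℕ} [Fact p.Prime]
    (hP : (univ.filter (· ∈ P)).card = p) (hM : Fintype.card H = 2 * p) :
    FormOK p (pAB (fun i => (A i).card) (fun i => (B i).card) (fun i => (C i).card))
      (pBC (fun i => (A i).card) (fun i => (B i).card) (fun i => (C i).card))
      (pCA (fun i => (A i).card) (fun i => (B i).card) (fun i => (C i).card))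
      (univ.sup fun i => (B i).card)
      ((diffUnion A B).filter (· ∈ P)).card ((diffUnion B C).filter (· ∈ P)).card
      ((diffUnion A C).filter (· ∈ P)).card := by
  set X := diffUnion A B; set Y := diffUnion B C; set Z := diffUnion A C
  set v := univ.sup fun i => (B i).card
  set X₀ := X.filter (· ∈ P); set X₁ := X.filter (fun w => ¬ w ∈ P)
  set Y₀ := Y.filter (· ∈ P); set Y₁ := Y.filter (fun w => ¬ w ∈ P)
  set Z₀ := Z.filter (· ∈ P); set Z₁ := Z.filter (fun w => ¬ w ∈ P)
  set Pf : Finset H := univ.filter (· ∈ P); set Pc : Finset H := univ.filter (fun w => ¬ w ∈ P)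
  -- cardinalities
  have hXc : X.card = pAB (fun i => (A i).card) (fun i => (B i).card) (fun i => (C i).card) := card_diffUnion_AB h hC
  have hYc : Y.card = pBC (fun i => (A i).card) (fun i => (B i).card) (fun i => (C i).card) := card_diffUnion_BC h hA
  have hZc : Z.card = pCA (fun i => (A i).card) (fun i => (B i).card) (fun i => (C i).card) := card_diffUnion_AC h hB
  have hX01 : X₀.card + X₁.card = X.card := card_filter_add_card_filter_not _
  have hY01 : Y₀.card + Y₁.card = Y.card := card_filter_add_card_filter_not _; have hZ01 : Z₀.card + Z₁.card = Z.card := card_filter_add_card_filter_not _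
  have hPc : Pc.card = p := by
    have := card_filter_add_card_filter_not (s := (univ : Finset H)) (· ∈ P)
    rw [card_univ, hM] at this
    change Pf.card + Pc.card = 2 * p at this
    omega
  -- index two
  have hPcard : Nat.card P = p := by rw [Nat.card_eq_fintype_card, Fintype.card_subtype, hP]
  have hidx : P.index = 2 := by
    have h1 := P.card_mul_index
    rw [hPcard, Nat.card_eq_fintype_card, hM, mul_comm 2 p] at h1
    exact Nat.eq_of_mul_eq_mul_left (Fact.out : p.Prime).pos h1
  have hadd : ∀ u w : H, u + w ∈ P ↔ (u ∈ P ↔ w ∈ P) := fun u w => AddSubgroup.add_mem_iff_of_index_two hidx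
  -- the representation count on `Z′`
  have hrZ : ∀ w ∈ Z, repCount X Y w ≤ v ∧ 1 ≤ repCount X Y w := by
    intro w hw
    simp only [Z, diffUnion, mem_biUnion, mem_univ, true_and] at hw
    obtain ⟨i, hi⟩ := hw
    rw [mem_sub] at hi
    obtain ⟨c', hc', a, ha, rfl⟩ := hi
    rw [repCount_eq h ha hc']
    exact ⟨le_sup (f := fun i => (B i).card) (mem_univ i), card_pos.mpr (hB i)⟩
  -- the four-term decomposition of `r_{X,Y}` and the vanishing of the wrong-parity terms
  have hXu : X₀ ∪ X₁ = X := filter_union_filter_not_eq _ X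
  have hYu : Y₀ ∪ Y₁ = Y := filter_union_filter_not_eq _ Y
  have hXd : Disjoint X₀ X₁ := disjoint_filter_filter_not X X _
  have hYd : Disjoint Y₀ Y₁ := disjoint_filter_filter_not Y Y _
  have hdec : ∀ w, repCount X Y w =
      (repCount X₀ Y₀ w + repCount X₀ Y₁ w) + (repCount X₁ Y₀ w + repCount X₁ Y₁ w) := by
    intro w
    rw [← hXu, ← hYu, repCount_union_left _ hXd, repCount_union_right _ hYd, repCount_union_right _ hYd]
  have mX₀ : ∀ u ∈ X₀, u ∈ P := fun u hu => (mem_filter.mp hu).2; have mY₀ : ∀ u ∈ Y₀, u ∈ P := fun u hu => (mem_filter.mp hu).2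
  have mX₁ : ∀ u ∈ X₁, u ∉ P := fun u hu => (mem_filter.mp hu).2; have mY₁ : ∀ u ∈ Y₁, u ∉ P := fun u hu => (mem_filter.mp hu).2
  have v01 : ∀ w, w ∈ P → repCount X₀ Y₁ w = 0 := fun w hw =>
    repCount_eq_zero fun u hu y hy he => mY₁ y hy (((hadd u y).mp (he ▸ hw)).mp (mX₀ u hu))
  have v10 : ∀ w, w ∈ P → repCount X₁ Y₀ w = 0 := fun w hw =>
    repCount_eq_zero fun u hu y hy he => mX₁ u hu (((hadd u y).mp (he ▸ hw)).mpr (mY₀ y hy))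
  have v00 : ∀ w, w ∉ P → repCount X₀ Y₀ w = 0 := fun w hw =>
    repCount_eq_zero fun u hu y hy he => hw (he ▸ P.add_mem (mX₀ u hu) (mY₀ y hy))
  have v11 : ∀ w, w ∉ P → repCount X₁ Y₁ w = 0 := fun w hw =>
    repCount_eq_zero fun u hu y hy he => hw (he ▸ (hadd u y).mpr ⟨fun h' => absurd h' (mX₁ u hu), fun h' => absurd h' (mY₁ y hy)⟩)
  -- base points of the classes
  obtain ⟨gX, hgX⟩ := exists_base_of_not_mem P hadd X₁ mX₁
  obtain ⟨gY, hgY⟩ := exists_base_of_not_mem P hadd Y₁ mY₁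
  have b0X : ∀ u ∈ X₀, u - 0 ∈ P := fun u hu => by rw [sub_zero]; exact mX₀ u hu
  have b0Y : ∀ u ∈ Y₀, u - 0 ∈ P := fun u hu => by rw [sub_zero]; exact mY₀ u hu
  have hZ₀ : Z₀ ⊆ Pf := fun w hw => mem_filter.mpr ⟨mem_univ _, (mem_filter.mp hw).2⟩
  have hZ₁ : Z₁ ⊆ Pc := fun w hw => mem_filter.mpr ⟨mem_univ _, (mem_filter.mp hw).2⟩
  -- rewrite the class sizes
  rw [← hXc, ← hYc, ← hZc, ← hX01, ← hY01, ← hZ01]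
  unfold FormOK
  simp only [Nat.add_sub_cancel_left]
  refine ⟨Nat.le_add_right _ _, Nat.le_add_right _ _, Nat.le_add_right _ _, hP ▸ card_le_card hZ₀, hPc ▸ card_le_card hZ₁,
    ?_, ?_, ?_, ?_⟩
  · -- coset `P`: pairs `(X₀, Y₀)`, `(X₁, Y₁)`, target `Z₀`
    refine cosetIneq_of P hP X₀ Y₀ X₁ Y₁ X Y Pf Z₀ v 0 0 gX gY b0X b0Y hgX hgY (fun w hw => ?_) (fun w => ?_) hP hZ₀
      (fun w hw => (hrZ w (mem_filter.mp hw).1).1)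
    · have hw' : w ∉ P := fun h' => hw (mem_filter.mpr ⟨mem_univ _, h'⟩)
      exact ⟨v00 w hw', v11 w hw'⟩
    · rw [hdec w]; omega
  · -- coset `P′`: pairs `(X₀, Y₁)`, `(X₁, Y₀)`, target `Z₁`
    refine cosetIneq_of P hP X₀ Y₁ X₁ Y₀ X Y Pc Z₁ v 0 gY gX 0 b0X hgY hgX b0Y (fun w hw => ?_) (fun w => ?_) hPc hZ₁
      (fun w hw => (hrZ w (mem_filter.mp hw).1).1)
    · have hw' : w ∈ P := by by_contra h'; exact hw (mem_filter.mpr ⟨mem_univ _, h'⟩)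
      exact ⟨v01 w hw', v10 w hw'⟩
    · rw [hdec w]; omega
  · -- mass, coset `P`
    refine mass_of X₀ Y₀ X₁ Y₁ X Y Pf Z₀ (fun w hw => ?_) hZ₀ (fun w hw => (hrZ w (mem_filter.mp hw).1).2)
    have hw' : w ∈ P := (mem_filter.mp hw).2
    rw [hdec w, v01 w hw', v10 w hw']; omega
  · -- mass, coset `P′`
    refine mass_of X₀ Y₁ X₁ Y₀ X Y Pc Z₁ (fun w hw => ?_) hZ₁ (fun w hw => (hrZ w (mem_filter.mp hw).1).2)
    have hw' : w ∉ P := (mem_filter.mp hw).2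
    rw [hdec w, v00 w hw', v11 w hw']; omega

/-- **Soundness of rule U11-F2**: the shape data of every `IsSTPP` family with non-empty sets in a finite abelian group of order `M`
is `FP2Adm M` (at `M = 2p`: Cauchy gives `P` of prime order `p`, necessarily of index `2`; form B is `formOK_of_isSTPP`, forms A and C
are form B of the rotated families `(C, A, B)`, `(B, C, A)` (`IsSTPP.rotate`), negation identifying the classes of `⋃(A − C)` / `⋃(C − A)`
etc.). [original] -/
theorem fp2Adm_of_isSTPP [Fintype H] {N : ℕ} {A B C : Fin N → Finset H} (h : IsSTPP A B C)
    (hne : ∀ i, (A i).Nonempty ∧ (B i).Nonempty ∧ (C i).Nonempty) :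
    FP2Adm (Fintype.card H) (fun i => (A i).card) (fun i => (B i).card) (fun i => (C i).card) := by
  intro p hM hp
  classical
  haveI : Fact p.Prime := ⟨hp⟩
  have hA : ∀ i, (A i).Nonempty := fun i => (hne i).1
  have hB : ∀ i, (B i).Nonempty := fun i => (hne i).2.1
  have hC : ∀ i, (C i).Nonempty := fun i => (hne i).2.2
  obtain ⟨g, hg⟩ := exists_prime_addOrderOf_dvd_card p (G := H) (by rw [hM]; exact Dvd.intro_left 2 rfl)
  set P := AddSubgroup.zmultiples g
  have hP : (univ.filter (· ∈ P)).card = p := by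
    rw [← Fintype.card_subtype, ← Nat.card_eq_fintype_card]
    change Nat.card (AddSubgroup.zmultiples g) = p
    rw [Nat.card_zmultiples, hg]
  refine ⟨_, _, _, formOK_of_isSTPP h hA hB hC P hP hM, ?_, ?_⟩
  · have h' := formOK_of_isSTPP h.rotate.rotate hC hA hB P hP hM
    rw [card_filter_diffUnion_swap P A C, card_filter_diffUnion_swap P B C] at h'
    exact h'
  · have h' := formOK_of_isSTPP h.rotate hB hC hA P hP hM
    rw [card_filter_diffUnion_swap P A C, card_filter_diffUnion_swap P A B] at h'
    exact h'

/-- **`FP2Sound`** — the rule in the census's item format: every STPP family with non-empty sets in a finite abelian group `H`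
satisfies `FP2Adm |H|` at its shape list. [original] -/
theorem fp2Sound : ∀ (H : Type) [AddCommGroup H] [Fintype H] (N : ℕ) (A B C : Fin N → Finset H), IsSTPP A B C →
    (∀ i, (A i).Nonempty ∧ (B i).Nonempty ∧ (C i).Nonempty) →
      FP2Adm (Fintype.card H) (fun i => (A i).card) (fun i => (B i).card) (fun i => (C i).card) := by
  intro H _ _ N A B C h hne
  classical
  exact fp2Adm_of_isSTPP h hne

end Sound

end FP2

end Summit.MatrixMultiplication.MatrixMultiplication.Theorems
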